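import Literature.NumberTheory.Irrationality.FischlerSprangZudilin2019.Asymptotics
import Mathlib.Analysis.SpecialFunctions.Log.NegMulLog
import Mathlib.Analysis.Calculus.Deriv.MeanValue
import HarnessLib

/-!
# Fischler–Sprang–Zudilin 2019, §4 Lemma 3 — part 1: the terms `c_{k,j}` and their uniform logarithmic size

Topic `Literature/NumberTheory/Irrationality/FischlerSprangZudilin2019`, namespace
`Literature.NumberTheory.Irrationality.FischlerSprangZudilin2019.Lemma3`. Source: S. Fischler, J. Sprang,
W. Zudilin, *Many odd zeta values are irrational*, Compositio Math. **155** (2019) 938–952 = arXiv:1803.08905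
[FischlerSprangZudilin2019], §4 "Asymptotic estimates of the linear forms", proof of Lemma 3 (held:
`paper:arxiv-1803.08905`, arXiv text pp. 7–8, read on the page). This is the first of four files PROVING the
tree's named fact `lemma3` (`Asymptotics.lean`); everything here is proved, no named facts.

## The source, verbatim (the step formalised here)
"For `j ∈ {1,…,D}` and `k ≥ 0`, let
`c_{k,j} = R_n(n+k+j/D) = D^{3Dn} n!^{s+1-3D} ∏_{ℓ=0}^{3Dn} (k + (j+ℓ)/D) / ∏_{ℓ=0}^{n} (n+k+ℓ+j/D)^{s+1}`,
so that `r_{n,j} = ∑_{m=1}^{∞} R_n(m + j/D) = ∑_{k=0}^{∞} c_{k,j}` is a sum of positive terms. …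
`c_{k,j} = D^{-1} n!^{s+1-3D} (3Dn+Dk+j)!/(Dk+j-1)! · Γ(n+k+j/D)^{s+1}/Γ(2n+k+1+j/D)^{s+1}`.
Denoting by `k₀(n)` the integer part of `x₀ n` and applying the Stirling formula to the factorial and gamma
factors we obtain, as `n → ∞`,
`c_{k₀(n),j}^{1/n} ∼ ((x₀+3)D)^{(x₀+3)D}/(x₀D)^{x₀D} · (x₀+1)^{(s+1)(x₀+1)}/(x₀+2)^{(s+1)(x₀+2)} = g(x₀) f(x₀)^{x₀}`
… for any `k` in the range `(x₀-3ε)n ≤ k ≤ (x₀+3ε)n` it follows from the proof of Eq. (4.4) that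
`g(x₀) - h(ε) ≤ c_{k,j}^{1/n} ≤ g(x₀) + h(ε)` for `n` large".

## What is proved here (and the one deviation from print)
* `cR s D n j k` is the printed closed form of `c_{k,j}` over `ℝ`, and `R_cast_eq_cR` identifies it with the
  tree's `R s D n` (`LinearForms.lean`) at `t = n + k + j/D`; `cR_pos`.
* `log_cR_eq`: `log c_{k,j} = -log D + (s+1-3D) log n! + ∑_{ℓ ≤ 3Dn} log(Dk+j+ℓ) - (s+1) ∑_{ℓ ≤ n} log(n+k+j/D+ℓ)`.
* DEVIATION (a shorter road than Stirling's formula for `Γ` at the shifted arguments `· + j/D`): with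
  `F(t) = t log t - t` (an antiderivative of `log`), the mean value theorem gives the elementary sandwich
  `F(a+N-1) - F(a-1) ≤ ∑_{ℓ<N} log(a+ℓ) ≤ F(a+N) - F(a)` (`sum_log_le`, `sum_log_ge`, `a ≥ 1`), i.e. Stirling's
  formula to the precision `O(log)` — all that the `n`-th root asymptotics use. With the scaling rule
  `F(ny) = n F(y) + ny log n` the main term is EXACTLY `n · L(k/n)` for the profile
  `L(x) = F(Dx+3D) - F(Dx) - (s+1)(F(x+2) - F(x+1)) - (s+1-3D)` (`Lprof`; the sibling file `Lemma3Profile.lean`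
  shows `L(x) = log g(x) + x log f(x)`, so `L(x₀) = log g(x₀)` — the printed `g(x₀) f(x₀)^{x₀}`), and the error is
  uniform: **`log_cR_sub_profile`**: `|log c_{k,j} - n L(k/n)| ≤ C (1 + log(n+1) + log(k+1))` for ALL `n ≥ 1`,
  `k ≥ 0`, `1 ≤ j ≤ D` (this uniformity is what the source's "it follows from the proof of Eq. (4.4)" uses on
  the window `|k - x₀n| ≤ 3εn`).

## Not here
The structure of `f` and `x₀`, the limits, the ratio `r_{n,j'}/r_{n,j} → 1` and the bound `g(x₀) < 3^{-(s+1)}`: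
sibling files `Lemma3Profile.lean`, `Lemma3Limit.lean`, `Lemma3Ratio.lean`. Cell zeta5-irr (rung F-Z1): nothing
here bears on `ζ(5)`.
-/

noncomputable section

open Finset Filter

open scoped Nat

namespace Literature.NumberTheory.Irrationality.FischlerSprangZudilin2019

namespace Lemma3

/-! ### `F(t) = t log t - t` and the mean-value sandwich for `∑ log(a+ℓ)` -/

/-- `F(t) = t log t - t`, the antiderivative of `log` used to sum logarithms (Stirling's formula to the
precision `O(log)`). [cite: FischlerSprangZudilin2019, §4 proof of Lemma 3 ("applying the Stirling formula")] -/
def F (t : ℝ) : ℝ := t * Real.log t - t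

/-- `F(0) = 0`. [cite: FischlerSprangZudilin2019, §4 proof of Lemma 3 (Stirling step)] -/
@[simp] theorem F_zero : F 0 = 0 := by simp [F]

/-- `F(1) = -1`. [cite: FischlerSprangZudilin2019, §4 proof of Lemma 3 (Stirling step)] -/
@[simp] theorem F_one : F 1 = -1 := by simp [F]

/-- `F' = log` away from `0`. [cite: FischlerSprangZudilin2019, §4 proof of Lemma 3 (Stirling step)] -/
theorem hasDerivAt_F {t : ℝ} (ht : t ≠ 0) : HasDerivAt F (Real.log t) t := by
  have h := (Real.hasDerivAt_mul_log ht).sub (hasDerivAt_id t)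
  simp only [add_sub_cancel_right] at h
  exact h

/-- `F` is continuous on `ℝ`. [cite: FischlerSprangZudilin2019, §4 proof of Lemma 3 (Stirling step)] -/
theorem continuous_F : Continuous F := Real.continuous_mul_log.sub continuous_id

/-- Mean value bound from above: `F(v) - F(u) ≤ (v-u) log v` for `0 ≤ u ≤ v`.
[cite: FischlerSprangZudilin2019, §4 proof of Lemma 3 (Stirling step)] -/
theorem F_sub_F_le {u v : ℝ} (hu : 0 ≤ u) (huv : u ≤ v) : F v - F u ≤ (v - u) * Real.log v := by
  rcases huv.eq_or_lt with rfl | hlt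
  · simp
  obtain ⟨ξ, hξ, hder⟩ := exists_hasDerivAt_eq_slope F Real.log hlt continuous_F.continuousOn
      (fun x hx => hasDerivAt_F (hu.trans_lt hx.1).ne')
  have hξv : Real.log ξ ≤ Real.log v := Real.log_le_log (hu.trans_lt hξ.1) hξ.2.le
  rw [hder, div_le_iff₀ (sub_pos.2 hlt)] at hξv
  linarith

/-- Mean value bound from below: `(v-u) log u ≤ F(v) - F(u)` for `0 < u ≤ v`.
[cite: FischlerSprangZudilin2019, §4 proof of Lemma 3 (Stirling step)] -/
theorem le_F_sub_F {u v : ℝ} (hu : 0 < u) (huv : u ≤ v) : (v - u) * Real.log u ≤ F v - F u := by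
  rcases huv.eq_or_lt with rfl | hlt
  · simp
  obtain ⟨ξ, hξ, hder⟩ := exists_hasDerivAt_eq_slope F Real.log hlt continuous_F.continuousOn
      (fun x hx => hasDerivAt_F (hu.trans hx.1).ne')
  have hξu : Real.log u ≤ Real.log ξ := Real.log_le_log hu hξ.1.le
  rw [hder, le_div_iff₀ (sub_pos.2 hlt)] at hξu
  linarith

/-- `F(v) - F(u) ≥ 0` for `1 ≤ u ≤ v`. [cite: FischlerSprangZudilin2019, §4 proof of Lemma 3 (Stirling step)] -/
theorem F_sub_F_nonneg {u v : ℝ} (hu : 1 ≤ u) (huv : u ≤ v) : 0 ≤ F v - F u :=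
  le_trans (mul_nonneg (sub_nonneg.2 huv) (Real.log_nonneg hu)) (le_F_sub_F (by linarith) huv)

/-- `F(v) - F(u) ≥ -1` for `0 ≤ u ≤ v` (the minimum of `F` is `F(1) = -1` and `F ≤ 0` on `[0,1]`).
[cite: FischlerSprangZudilin2019, §4 proof of Lemma 3 (Stirling step)] -/
theorem neg_one_le_F_sub_F {u v : ℝ} (hu : 0 ≤ u) (huv : u ≤ v) : -1 ≤ F v - F u := by
  have hv : -1 ≤ F v := by
    have := Real.self_sub_one_le_mul_log (hu.trans huv)
    unfold F
    linarith
  by_cases h1 : u ≤ 1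
  · have : F u ≤ 0 := by
      have := Real.mul_log_nonpos hu h1
      unfold F
      linarith
    linarith
  · push Not at h1
    have := F_sub_F_nonneg h1.le huv
    linarith

/-- **Upper sandwich**: `∑_{ℓ<N} log(a+ℓ) ≤ F(a+N) - F(a)` for `a > 0`.
[cite: FischlerSprangZudilin2019, §4 proof of Lemma 3 (Stirling step)] -/
theorem sum_log_le {a : ℝ} (ha : 0 < a) (N : ℕ) :
    ∑ ℓ ∈ range N, Real.log (a + ℓ) ≤ F (a + N) - F a := by
  induction N with
  | zero => simp
  | succ N ih =>
    rw [sum_range_succ]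
    have h := le_F_sub_F (u := a + N) (v := a + N + 1) (by positivity) (by linarith)
    have e : a + (N : ℝ) + 1 - (a + N) = 1 := by ring
    rw [e, one_mul] at h
    push_cast
    rw [show a + ((N : ℝ) + 1) = a + N + 1 by ring]
    linarith

/-- **Lower sandwich**: `F(a-1+N) - F(a-1) ≤ ∑_{ℓ<N} log(a+ℓ)` for `a ≥ 1`.
[cite: FischlerSprangZudilin2019, §4 proof of Lemma 3 (Stirling step)] -/
theorem sum_log_ge' {a : ℝ} (ha : 1 ≤ a) (N : ℕ) :
    F (a - 1 + N) - F (a - 1) ≤ ∑ ℓ ∈ range N, Real.log (a + ℓ) := by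
  induction N with
  | zero => simp
  | succ N ih =>
    rw [sum_range_succ]
    have h := F_sub_F_le (u := a - 1 + N) (v := a + N) (by linarith) (by linarith)
    have e : a + (N : ℝ) - (a - 1 + N) = 1 := by ring
    rw [e, one_mul] at h
    push_cast
    rw [show a - 1 + ((N : ℝ) + 1) = a + N by ring]
    linarith

/-- **Lower sandwich, convenient form**: `F(a+N) - F(a) - log(a+N) - 1 ≤ ∑_{ℓ<N} log(a+ℓ)` for `a ≥ 1`.
[cite: FischlerSprangZudilin2019, §4 proof of Lemma 3 (Stirling step)] -/
theorem sum_log_ge {a : ℝ} (ha : 1 ≤ a) (N : ℕ) :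
    F (a + N) - F a - Real.log (a + N) - 1 ≤ ∑ ℓ ∈ range N, Real.log (a + ℓ) := by
  have h1 := sum_log_ge' ha N
  have h2 : F (a + N) - F (a - 1 + N) ≤ (a + N - (a - 1 + N)) * Real.log (a + N) :=
    F_sub_F_le (by linarith) (by linarith)
  have e : a + (N : ℝ) - (a - 1 + N) = 1 := by ring
  rw [e, one_mul] at h2
  have h3 : -1 ≤ F a - F (a - 1) := neg_one_le_F_sub_F (by linarith) (by linarith)
  linarith

/-- `log n! = ∑_{ℓ<n} log(1+ℓ)`. [cite: FischlerSprangZudilin2019, §4 proof of Lemma 3 (Stirling step)] -/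
theorem log_factorial_eq_sum (n : ℕ) :
    Real.log (n ! : ℝ) = ∑ ℓ ∈ range n, Real.log ((1 : ℝ) + ℓ) := by
  induction n with
  | zero => simp
  | succ n ih =>
    rw [Nat.factorial_succ, Nat.cast_mul, Real.log_mul (by positivity) (by positivity), ih,
      sum_range_succ]
    push_cast
    ring

/-- `|log n! - F(n)| ≤ log(n+1) + 1` for `n ≥ 1`.
[cite: FischlerSprangZudilin2019, §4 proof of Lemma 3 (Stirling step)] -/
theorem abs_log_factorial_sub_F_le {n : ℕ} (hn : 1 ≤ n) :
    |Real.log (n ! : ℝ) - F n| ≤ Real.log ((n : ℝ) + 1) + 1 := by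
  rw [log_factorial_eq_sum]
  have hU := sum_log_le (a := 1) one_pos n
  have hL := sum_log_ge (a := 1) le_rfl n
  have hn' : (1 : ℝ) ≤ n := by exact_mod_cast hn
  have h0 : 0 ≤ F ((n : ℝ) + 1) - F n := F_sub_F_nonneg hn' (by linarith)
  have h1 : F ((n : ℝ) + 1) - F n ≤ Real.log ((n : ℝ) + 1) := by
    have := F_sub_F_le (u := (n : ℝ)) (v := n + 1) (by linarith) (by linarith)
    rwa [show (n : ℝ) + 1 - n = 1 by ring, one_mul] at this
  rw [show (1 : ℝ) + n = n + 1 by ring, F_one] at hU hL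
  rw [abs_le]
  constructor <;> linarith

/-! ### The terms `c_{k,j}` -/

/-- **`c_{k,j} = R_n(n+k+j/D) = D^{3Dn} n!^{s+1-3D} ∏_{ℓ=0}^{3Dn}(k + (j+ℓ)/D) / ∏_{ℓ=0}^{n}(n+k+ℓ+j/D)^{s+1}`**
(over `ℝ`). [cite: FischlerSprangZudilin2019, §4 proof of Lemma 3 (definition of c_{k,j})] -/
def cR (s D n j k : ℕ) : ℝ :=
  (D : ℝ) ^ (3 * D * n) * (n ! : ℝ) ^ (s + 1 - 3 * D) *
      (∏ ℓ ∈ range (3 * D * n + 1), ((k : ℝ) + ((j : ℝ) + ℓ) / D)) /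
    (∏ ℓ ∈ range (n + 1), ((n : ℝ) + k + (j : ℝ) / D + ℓ)) ^ (s + 1)

/-- `c_{k,j}` is the tree's `R_n` at `t = m + 1 + j/D` with `m = n - 1 + k` (the `(n-1+k)`-th term of the series
defining `r_{n,j}`). [cite: FischlerSprangZudilin2019, §4 proof of Lemma 3 (c_{k,j} = R_n(n+k+j/D))] -/
theorem R_cast_eq_cR {s D n : ℕ} (hn : 1 ≤ n) (j k : ℕ) :
    ((R s D n (((n - 1 + k : ℕ) : ℚ) + 1 + (j : ℚ) / D) : ℚ) : ℝ) = cR s D n j k := by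
  have hcast : (((n - 1 + k : ℕ) : ℚ) + 1 + (j : ℚ) / D) = (n : ℚ) + k + (j : ℚ) / D := by
    rw [Nat.cast_add, Nat.cast_sub hn]
    push_cast
    ring
  have hnum : (∏ ℓ ∈ range (3 * D * n + 1), ((n : ℚ) + k + (j : ℚ) / D - n + (ℓ : ℚ) / D)) =
      ∏ ℓ ∈ range (3 * D * n + 1), ((k : ℚ) + ((j : ℚ) + ℓ) / D) :=
    prod_congr rfl fun ℓ _ => by ring
  rw [hcast, R, hnum, cR]
  push_cast
  rfl

/-- Each numerator factor `k + (j+ℓ)/D` is positive (`j ≥ 1`).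
[cite: FischlerSprangZudilin2019, §4 proof of Lemma 3 ("a sum of positive terms")] -/
theorem num_factor_pos {D j : ℕ} (hj : 1 ≤ j) (hjD : j ≤ D) (k ℓ : ℕ) :
    0 < (k : ℝ) + ((j : ℝ) + ℓ) / D := by
  have hD : (0 : ℝ) < D := by exact_mod_cast (hj.trans hjD)
  have hj' : (1 : ℝ) ≤ j := by exact_mod_cast hj
  positivity

/-- Each denominator factor `n + k + j/D + ℓ` is at least `1` (`n ≥ 1`).
[cite: FischlerSprangZudilin2019, §4 proof of Lemma 3 ("a sum of positive terms")] -/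
theorem one_le_den_factor {D n j : ℕ} (hn : 1 ≤ n) (k ℓ : ℕ) :
    (1 : ℝ) ≤ (n : ℝ) + k + (j : ℝ) / D + ℓ := by
  have hn' : (1 : ℝ) ≤ n := by exact_mod_cast hn
  have : (0 : ℝ) ≤ (j : ℝ) / D := by positivity
  have : (0 : ℝ) ≤ (k : ℝ) := by positivity
  have : (0 : ℝ) ≤ (ℓ : ℝ) := by positivity
  linarith

/-- **`c_{k,j} > 0`** (`n ≥ 1`, `1 ≤ j ≤ D`). [cite: FischlerSprangZudilin2019, §4 proof of Lemma 3 ("a sum of positive terms")] -/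
theorem cR_pos {s D n j : ℕ} (hn : 1 ≤ n) (hj : 1 ≤ j) (hjD : j ≤ D) (k : ℕ) : 0 < cR s D n j k := by
  have hD : (0 : ℝ) < D := by exact_mod_cast (hj.trans hjD)
  unfold cR
  refine div_pos (mul_pos (by positivity) (prod_pos fun ℓ _ => num_factor_pos hj hjD k ℓ))
    (pow_pos (prod_pos fun ℓ _ => ?_) _)
  linarith [one_le_den_factor (D := D) (j := j) hn k ℓ]

/-- **The logarithm of `c_{k,j}`**:
`log c_{k,j} = -log D + (s+1-3D) log n! + ∑_{ℓ ≤ 3Dn} log(Dk+j+ℓ) - (s+1) ∑_{ℓ ≤ n} log(n+k+j/D+ℓ)`.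
[cite: FischlerSprangZudilin2019, §4 proof of Lemma 3 (c_{k,j} through factorials and Γ)] -/
theorem log_cR_eq {s D n j : ℕ} (hn : 1 ≤ n) (hj : 1 ≤ j) (hjD : j ≤ D) (k : ℕ) :
    Real.log (cR s D n j k) = -Real.log D + ((s + 1 - 3 * D : ℕ) : ℝ) * Real.log (n ! : ℝ) +
      ∑ ℓ ∈ range (3 * D * n + 1), Real.log (((D * k + j : ℕ) : ℝ) + ℓ) -
      ((s + 1 : ℕ) : ℝ) * ∑ ℓ ∈ range (n + 1), Real.log (((n : ℝ) + k + (j : ℝ) / D) + ℓ) := by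
  have hD : (0 : ℝ) < D := by exact_mod_cast (hj.trans hjD)
  have hnum : ∀ ℓ ∈ range (3 * D * n + 1), ((k : ℝ) + ((j : ℝ) + ℓ) / D) ≠ 0 :=
    fun ℓ _ => (num_factor_pos hj hjD k ℓ).ne'
  have hden : ∀ ℓ ∈ range (n + 1), ((n : ℝ) + k + (j : ℝ) / D + ℓ) ≠ 0 :=
    fun ℓ _ => by linarith [one_le_den_factor (D := D) (j := j) hn k ℓ]
  have hP : 0 < ∏ ℓ ∈ range (3 * D * n + 1), ((k : ℝ) + ((j : ℝ) + ℓ) / D) :=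
    prod_pos fun ℓ _ => num_factor_pos hj hjD k ℓ
  have hQ : 0 < ∏ ℓ ∈ range (n + 1), ((n : ℝ) + k + (j : ℝ) / D + ℓ) :=
    prod_pos fun ℓ _ => by linarith [one_le_den_factor (D := D) (j := j) hn k ℓ]
  unfold cR
  rw [Real.log_div (by positivity) (by positivity), Real.log_mul (by positivity) hP.ne',
    Real.log_mul (by positivity) (by positivity), Real.log_pow, Real.log_pow, Real.log_pow,
    Real.log_prod hnum, Real.log_prod hden]
  have hterm : ∀ ℓ ∈ range (3 * D * n + 1),
      Real.log ((k : ℝ) + ((j : ℝ) + ℓ) / D) = Real.log (((D * k + j : ℕ) : ℝ) + ℓ) - Real.log D := by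
    intro ℓ _
    have e : (k : ℝ) + ((j : ℝ) + ℓ) / D = ((((D * k + j : ℕ) : ℝ) + ℓ)) / D := by
      push_cast
      field_simp
      ring
    rw [e, Real.log_div _ hD.ne']
    have h1 : (1 : ℝ) ≤ ((D * k + j : ℕ) : ℝ) := by exact_mod_cast (le_add_left hj : 1 ≤ D * k + j)
    have : (0 : ℝ) < ((D * k + j : ℕ) : ℝ) + ℓ := by positivity
    exact this.ne'
  rw [sum_congr rfl hterm, sum_sub_distrib, sum_const, card_range, nsmul_eq_mul]
  push_cast
  ring

/-! ### The profile `L` and the exact main term -/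

/-- **The logarithmic profile** `L(x) = F(Dx+3D) - F(Dx) - (s+1)(F(x+2) - F(x+1)) - (s+1-3D)`; the sibling
file shows `L(x) = log g(x) + x log f(x)`, so that `L(x₀) = log g(x₀)` is the printed limit
`log(g(x₀) f(x₀)^{x₀})`. [cite: FischlerSprangZudilin2019, §4 proof of Lemma 3, eq. (4.4)] -/
def Lprof (s D : ℕ) (x : ℝ) : ℝ :=
  F (D * x + 3 * D) - F (D * x) - ((s : ℝ) + 1) * (F (x + 2) - F (x + 1)) - ((s : ℝ) + 1 - 3 * D)

/-- Scaling rule `F(cy) = c F(y) + c y log c` (`c > 0`, `y ≥ 0`).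
[cite: FischlerSprangZudilin2019, §4 proof of Lemma 3 (Stirling step)] -/
theorem F_mul {c y : ℝ} (hc : 0 < c) (hy : 0 ≤ y) : F (c * y) = c * F y + c * y * Real.log c := by
  rcases hy.eq_or_lt with h | hy'
  · rw [← h]
    simp
  · unfold F
    rw [Real.log_mul hc.ne' hy'.ne']
    ring

/-- **The main term is exact**: `n · L(k/n) = (s+1-3D) F(n) + F(Dk+3Dn) - F(Dk) - (s+1)(F(k+2n) - F(k+n))`.
[cite: FischlerSprangZudilin2019, §4 proof of Lemma 3, eq. (4.4)] -/
theorem mul_Lprof_div {s D n : ℕ} (hn : 1 ≤ n) (k : ℕ) :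
    (n : ℝ) * Lprof s D ((k : ℝ) / n) = ((s : ℝ) + 1 - 3 * D) * F n + F ((D : ℝ) * k + 3 * D * n) -
      F ((D : ℝ) * k) - ((s : ℝ) + 1) * (F ((k : ℝ) + 2 * n) - F ((k : ℝ) + n)) := by
  have hn0 : (0 : ℝ) < n := by exact_mod_cast hn
  have hn1 : (n : ℝ) ≠ 0 := hn0.ne'
  have e1 : F ((D : ℝ) * k + 3 * D * n) = n * F ((D : ℝ) * (k / n) + 3 * D) +
      n * ((D : ℝ) * (k / n) + 3 * D) * Real.log n := by
    rw [← F_mul hn0 (by positivity)]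
    congr 1
    field_simp
  have e2 : F ((D : ℝ) * k) = n * F ((D : ℝ) * (k / n)) + n * ((D : ℝ) * (k / n)) * Real.log n := by
    rw [← F_mul hn0 (by positivity)]
    congr 1
    field_simp
  have e3 : F ((k : ℝ) + 2 * n) = n * F ((k : ℝ) / n + 2) + n * ((k : ℝ) / n + 2) * Real.log n := by
    rw [← F_mul hn0 (by positivity)]
    congr 1
    field_simp
  have e4 : F ((k : ℝ) + n) = n * F ((k : ℝ) / n + 1) + n * ((k : ℝ) / n + 1) * Real.log n := by
    rw [← F_mul hn0 (by positivity)]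
    congr 1
    field_simp
  have e5 : F (n : ℝ) = n * F 1 + n * 1 * Real.log n := by
    rw [← F_mul hn0 zero_le_one, mul_one]
  rw [e1, e2, e3, e4, e5, F_one, Lprof]
  field_simp
  ring

/-! ### The uniform estimate -/

/-- `log(Dk+D+3Dn+1) ≤ log(3D) + log(n+1) + log(k+1)` (`D, n ≥ 1`).
[cite: FischlerSprangZudilin2019, §4 proof of Lemma 3 (Stirling step)] -/
theorem log_lin_le₁ {D n : ℕ} (hD : 1 ≤ D) (hn : 1 ≤ n) (k : ℕ) :
    Real.log ((D : ℝ) * k + D + 3 * D * n + 1) ≤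
      Real.log (3 * D) + Real.log ((n : ℝ) + 1) + Real.log ((k : ℝ) + 1) := by
  have hD' : (1 : ℝ) ≤ D := by exact_mod_cast hD
  have hn' : (1 : ℝ) ≤ n := by exact_mod_cast hn
  have hk : (0 : ℝ) ≤ k := by positivity
  rw [← Real.log_mul (by positivity) (by positivity), ← Real.log_mul (by positivity) (by positivity)]
  refine Real.log_le_log (by positivity) ?_
  nlinarith [mul_nonneg hk (by linarith : (0 : ℝ) ≤ n - 1), mul_nonneg (by linarith : (0:ℝ) ≤ D - 1) hk,
    mul_nonneg (mul_nonneg (by linarith : (0:ℝ) ≤ D) hk) (by linarith : (0 : ℝ) ≤ n)]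

/-- `log(k+2n+3) ≤ log 3 + log(n+1) + log(k+1)`. [cite: FischlerSprangZudilin2019, §4 proof of Lemma 3 (Stirling step)] -/
theorem log_lin_le₂ (n k : ℕ) :
    Real.log ((k : ℝ) + 2 * n + 3) ≤ Real.log 3 + Real.log ((n : ℝ) + 1) + Real.log ((k : ℝ) + 1) := by
  have hn : (0 : ℝ) ≤ n := by positivity
  have hk : (0 : ℝ) ≤ k := by positivity
  rw [← Real.log_mul (by positivity) (by positivity), ← Real.log_mul (by positivity) (by positivity)]
  refine Real.log_le_log (by positivity) ?_
  nlinarith [mul_nonneg hk hn]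

/-- **Uniform Stirling estimate for `c_{k,j}`**: there is `C = C(s,D)` with
`|log c_{k,j} - n L(k/n)| ≤ C (1 + log(n+1) + log(k+1))` for all `n ≥ 1`, `k ≥ 0`, `1 ≤ j ≤ D`
(`s ≥ 3D`). [cite: FischlerSprangZudilin2019, §4 proof of Lemma 3, eq. (4.4) and "it follows from the proof of Eq. (4.4)"] -/
theorem log_cR_sub_profile {s D : ℕ} (hD : 1 ≤ D) (h3D : 3 * D ≤ s) :
    ∃ C : ℝ, 0 < C ∧ ∀ n k j : ℕ, 1 ≤ n → 1 ≤ j → j ≤ D →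
      |Real.log (cR s D n j k) - n * Lprof s D ((k : ℝ) / n)| ≤
        C * (1 + Real.log ((n : ℝ) + 1) + Real.log ((k : ℝ) + 1)) := by
  have hD' : (1 : ℝ) ≤ D := by exact_mod_cast hD
  have h3D' : (3 : ℝ) * D ≤ s := by exact_mod_cast h3D
  have ha1 : (1 : ℝ) ≤ (s : ℝ) + 1 - 3 * D := by linarith
  have hlog3D : 0 ≤ Real.log (3 * D) := Real.log_nonneg (by linarith)
  have hlog3 : 0 ≤ Real.log 3 := Real.log_nonneg (by norm_num)
  have hlogD : 0 ≤ Real.log D := Real.log_nonneg hD'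
  have hs1 : (0 : ℝ) ≤ (s : ℝ) + 1 := by positivity
  have h2D1 : (0 : ℝ) ≤ 2 * D + 1 := by positivity
  refine ⟨Real.log D + 2 * ((s : ℝ) + 1 - 3 * D) + (2 * D + 1) * (Real.log (3 * D) + 1) + 1 +
      ((s : ℝ) + 1) * (2 * Real.log 3 + 3), ?_, ?_⟩
  · have := mul_nonneg h2D1 (add_nonneg hlog3D zero_le_one)
    have := mul_nonneg hs1 (by linarith : (0 : ℝ) ≤ 2 * Real.log 3 + 3)
    linarith
  intro n k j hn hj hjD
  have hn' : (1 : ℝ) ≤ n := by exact_mod_cast hn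
  have hj' : (1 : ℝ) ≤ j := by exact_mod_cast hj
  have hjD' : (j : ℝ) ≤ D := by exact_mod_cast hjD
  have hk : (0 : ℝ) ≤ k := by positivity
  have hDpos : (0 : ℝ) < D := by linarith
  have hDk : (0 : ℝ) ≤ (D : ℝ) * k := by positivity
  have hDn : (1 : ℝ) ≤ (D : ℝ) * n := by nlinarith
  have hcast : ((s + 1 - 3 * D : ℕ) : ℝ) = (s : ℝ) + 1 - 3 * D := by
    rw [Nat.cast_sub (by omega), Nat.cast_add, Nat.cast_mul]
    push_cast
    ring
  have hsn : ((s + 1 : ℕ) : ℝ) = (s : ℝ) + 1 := by push_cast; ring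
  have ha₂' : ((D * k + j : ℕ) : ℝ) = (D : ℝ) * k + j := by push_cast; ring
  rw [log_cR_eq hn hj hjD, mul_Lprof_div hn, hcast, hsn, ha₂']
  -- (1) log n!
  have h1 := abs_log_factorial_sub_F_le hn
  rw [abs_le] at h1
  obtain ⟨h1l, h1u⟩ := h1
  -- (2) the numerator sum: a = Dk + j ≥ 1, N = 3Dn + 1, against F(Dk+3Dn) - F(Dk)
  have ha₂ : (1 : ℝ) ≤ (D : ℝ) * k + j := by linarith
  have hN₂ : ((3 * D * n + 1 : ℕ) : ℝ) = 3 * D * n + 1 := by push_cast; ring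
  have hU₂ := sum_log_le (a := (D : ℝ) * k + j) (by linarith) (3 * D * n + 1)
  have hL₂ := sum_log_ge (a := (D : ℝ) * k + j) ha₂ (3 * D * n + 1)
  rw [hN₂] at hU₂ hL₂
  set S₂ := ∑ ℓ ∈ range (3 * D * n + 1), Real.log ((D : ℝ) * k + j + ℓ) with hS₂
  set L₁ := Real.log ((D : ℝ) * k + D + 3 * D * n + 1) with hL₁
  have hL₁0 : 0 ≤ L₁ := Real.log_nonneg (by linarith)
  have hv₂ : 0 ≤ Real.log ((D : ℝ) * k + j + (3 * D * n + 1)) ∧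
      Real.log ((D : ℝ) * k + j + (3 * D * n + 1)) ≤ L₁ :=
    ⟨Real.log_nonneg (by linarith), Real.log_le_log (by linarith) (by linarith)⟩
  have h2a : 0 ≤ F ((D : ℝ) * k + j + (3 * D * n + 1)) - F ((D : ℝ) * k + 3 * D * n) ∧
      F ((D : ℝ) * k + j + (3 * D * n + 1)) - F ((D : ℝ) * k + 3 * D * n) ≤ ((D : ℝ) + 1) * L₁ := by
    have hu : (1 : ℝ) ≤ (D : ℝ) * k + 3 * D * n := by linarith
    have huv : (D : ℝ) * k + 3 * D * n ≤ (D : ℝ) * k + j + (3 * D * n + 1) := by linarith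
    refine ⟨F_sub_F_nonneg hu huv, (F_sub_F_le (by linarith) huv).trans ?_⟩
    rw [show (D : ℝ) * k + j + (3 * D * n + 1) - ((D : ℝ) * k + 3 * D * n) = j + 1 by ring]
    calc ((j : ℝ) + 1) * Real.log ((D : ℝ) * k + j + (3 * D * n + 1))
        ≤ ((j : ℝ) + 1) * L₁ := mul_le_mul_of_nonneg_left hv₂.2 (by positivity)
      _ ≤ ((D : ℝ) + 1) * L₁ := mul_le_mul_of_nonneg_right (by linarith) hL₁0
  have h2b : -1 ≤ F ((D : ℝ) * k + j) - F ((D : ℝ) * k) ∧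
      F ((D : ℝ) * k + j) - F ((D : ℝ) * k) ≤ (D : ℝ) * L₁ := by
    have huv : (D : ℝ) * k ≤ (D : ℝ) * k + j := by linarith
    refine ⟨neg_one_le_F_sub_F hDk huv, (F_sub_F_le hDk huv).trans ?_⟩
    rw [show (D : ℝ) * k + j - (D : ℝ) * k = j by ring]
    have hle : Real.log ((D : ℝ) * k + j) ≤ L₁ := Real.log_le_log (by linarith) (by linarith)
    calc (j : ℝ) * Real.log ((D : ℝ) * k + j) ≤ (j : ℝ) * L₁ := mul_le_mul_of_nonneg_left hle (by positivity)
      _ ≤ (D : ℝ) * L₁ := mul_le_mul_of_nonneg_right hjD' hL₁0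
  have hE₂l : -((2 * (D : ℝ) + 1) * L₁ + 1) ≤ S₂ - (F ((D : ℝ) * k + 3 * D * n) - F ((D : ℝ) * k)) := by
    linarith [h2a.1, h2b.2, hv₂.1, hv₂.2, hL₂, mul_nonneg hDpos.le hL₁0]
  have hE₂u : S₂ - (F ((D : ℝ) * k + 3 * D * n) - F ((D : ℝ) * k)) ≤ (2 * (D : ℝ) + 1) * L₁ + 1 := by
    linarith [h2a.2, h2b.1, hU₂, mul_nonneg hDpos.le hL₁0]
  -- (3) the denominator sum: a = n + k + j/D ≥ 1, N = n + 1, against F(k+2n) - F(k+n)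
  have hjDle : (j : ℝ) / D ≤ 1 := by rw [div_le_one hDpos]; exact hjD'
  have hjDpos : 0 < (j : ℝ) / D := by positivity
  have ha₃ : (1 : ℝ) ≤ (n : ℝ) + k + (j : ℝ) / D := by linarith
  have hN₃ : ((n + 1 : ℕ) : ℝ) = (n : ℝ) + 1 := by push_cast; ring
  have hU₃ := sum_log_le (a := (n : ℝ) + k + (j : ℝ) / D) (by linarith) (n + 1)
  have hL₃ := sum_log_ge (a := (n : ℝ) + k + (j : ℝ) / D) ha₃ (n + 1)
  rw [hN₃] at hU₃ hL₃
  set S₃ := ∑ ℓ ∈ range (n + 1), Real.log ((n : ℝ) + k + (j : ℝ) / D + ℓ) with hS₃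
  set L₂ := Real.log ((k : ℝ) + 2 * n + 3) with hL₂
  have hL₂0 : 0 ≤ L₂ := Real.log_nonneg (by linarith)
  have hv₃ : 0 ≤ Real.log ((n : ℝ) + k + (j : ℝ) / D + (n + 1)) ∧
      Real.log ((n : ℝ) + k + (j : ℝ) / D + (n + 1)) ≤ L₂ :=
    ⟨Real.log_nonneg (by linarith), Real.log_le_log (by linarith) (by linarith)⟩
  have h3a : 0 ≤ F ((n : ℝ) + k + (j : ℝ) / D + (n + 1)) - F ((k : ℝ) + 2 * n) ∧
      F ((n : ℝ) + k + (j : ℝ) / D + (n + 1)) - F ((k : ℝ) + 2 * n) ≤ 2 * L₂ := by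
    have hu : (1 : ℝ) ≤ (k : ℝ) + 2 * n := by linarith
    have huv : (k : ℝ) + 2 * n ≤ (n : ℝ) + k + (j : ℝ) / D + (n + 1) := by linarith
    refine ⟨F_sub_F_nonneg hu huv, (F_sub_F_le (by linarith) huv).trans ?_⟩
    rw [show (n : ℝ) + k + (j : ℝ) / D + (n + 1) - ((k : ℝ) + 2 * n) = (j : ℝ) / D + 1 by ring]
    calc ((j : ℝ) / D + 1) * Real.log ((n : ℝ) + k + (j : ℝ) / D + (n + 1))
        ≤ ((j : ℝ) / D + 1) * L₂ := mul_le_mul_of_nonneg_left hv₃.2 (by positivity)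
      _ ≤ 2 * L₂ := mul_le_mul_of_nonneg_right (by linarith) hL₂0
  have h3b : 0 ≤ F ((n : ℝ) + k + (j : ℝ) / D) - F ((k : ℝ) + n) ∧
      F ((n : ℝ) + k + (j : ℝ) / D) - F ((k : ℝ) + n) ≤ L₂ := by
    have hu : (1 : ℝ) ≤ (k : ℝ) + n := by linarith
    have huv : (k : ℝ) + n ≤ (n : ℝ) + k + (j : ℝ) / D := by linarith
    refine ⟨F_sub_F_nonneg hu huv, (F_sub_F_le (by linarith) huv).trans ?_⟩
    rw [show (n : ℝ) + k + (j : ℝ) / D - ((k : ℝ) + n) = (j : ℝ) / D by ring]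
    have hle : Real.log ((n : ℝ) + k + (j : ℝ) / D) ≤ L₂ := Real.log_le_log (by linarith) (by linarith)
    calc (j : ℝ) / D * Real.log ((n : ℝ) + k + (j : ℝ) / D) ≤ (j : ℝ) / D * L₂ :=
          mul_le_mul_of_nonneg_left hle hjDpos.le
      _ ≤ 1 * L₂ := mul_le_mul_of_nonneg_right hjDle hL₂0
      _ = L₂ := one_mul _
  have hE₃l : -(2 * L₂ + 1) ≤ S₃ - (F ((k : ℝ) + 2 * n) - F ((k : ℝ) + n)) := by
    linarith [h3a.1, h3b.2, hv₃.1, hv₃.2, hL₃]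
  have hE₃u : S₃ - (F ((k : ℝ) + 2 * n) - F ((k : ℝ) + n)) ≤ 2 * L₂ + 1 := by
    linarith [h3a.2, h3b.1, hU₃]
  -- the two logarithms against log(n+1) + log(k+1)
  have hl₁ : L₁ ≤ Real.log (3 * D) + Real.log ((n : ℝ) + 1) + Real.log ((k : ℝ) + 1) := log_lin_le₁ hD hn k
  have hl₂ : L₂ ≤ Real.log 3 + Real.log ((n : ℝ) + 1) + Real.log ((k : ℝ) + 1) := log_lin_le₂ n k
  set ln := Real.log ((n : ℝ) + 1) with hln
  set lk := Real.log ((k : ℝ) + 1) with hlk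
  have hlogn : 0 ≤ ln := Real.log_nonneg (by linarith)
  have hlogk : 0 ≤ lk := Real.log_nonneg (by linarith)
  -- products, stated for `linarith`
  have p1l := mul_le_mul_of_nonneg_left h1l (by linarith : (0 : ℝ) ≤ (s : ℝ) + 1 - 3 * D)
  have p1u := mul_le_mul_of_nonneg_left h1u (by linarith : (0 : ℝ) ≤ (s : ℝ) + 1 - 3 * D)
  have p3l := mul_le_mul_of_nonneg_left hE₃l hs1
  have p3u := mul_le_mul_of_nonneg_left hE₃u hs1
  have q1 := mul_le_mul_of_nonneg_left hl₁ h2D1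
  have q2 := mul_le_mul_of_nonneg_left hl₂ hs1
  have nn1 : 0 ≤ Real.log D * (ln + lk) := mul_nonneg hlogD (add_nonneg hlogn hlogk)
  have nn2 : 0 ≤ ((s : ℝ) + 1 - 3 * D) * (ln + lk) := mul_nonneg (by linarith) (add_nonneg hlogn hlogk)
  have nn2' : 0 ≤ ((s : ℝ) + 1 - 3 * D) * lk := mul_nonneg (by linarith) hlogk
  have nn3 : 0 ≤ (2 * (D : ℝ) + 1) * Real.log (3 * D) * (ln + lk) :=
    mul_nonneg (mul_nonneg h2D1 hlog3D) (add_nonneg hlogn hlogk)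
  have nn4 : 0 ≤ ((s : ℝ) + 1) * Real.log 3 * (ln + lk) :=
    mul_nonneg (mul_nonneg hs1 hlog3) (add_nonneg hlogn hlogk)
  have nn5 : 0 ≤ ((s : ℝ) + 1) * (ln + lk) := mul_nonneg hs1 (add_nonneg hlogn hlogk)
  have nn6 : 0 ≤ (2 * (D : ℝ) + 1) * (ln + lk) := mul_nonneg h2D1 (add_nonneg hlogn hlogk)
  rw [abs_le]
  constructor <;> linarith

end Lemma3

end Literature.NumberTheory.Irrationality.FischlerSprangZudilin2019
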